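import Literature.Probability.LatticeModels.CurrentsEdgeAvoidance
import HarnessLib

/-!
# The law of the trace of the box currents on finitely many bonds, and its limit

Trunk G02 (T-STATMECH), topic `Probability/LatticeModels`, namespace `Literature.StatMech`. Second step
of the construction of the infinite-volume random currents (ADS15 Thm. 2.3, R1; the named fact
`Literature.Probability.LatticeModels.ads_doubleCurrent_limit_exists` of the companion file `DoubleCurrentsInfinite.lean`), after
`CurrentsEdgeAvoidance.lean` (ADS15 (2.13)–(2.14): the avoidance probabilities
`P̂^#_{Λ_L,β}[n ≡ 0 on T] = ⟨e^{-βK_T}⟩^#_{Λ_L}` converge):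

* M. Aizenman, H. Duminil-Copin, V. Sidoravicius, *Random currents and continuity of Ising
  model's spontaneous magnetization*, Comm. Math. Phys. **334** (2015) 719–742, proof of Thm. 2.3
  (R1) (arXiv:1311.1937v3; bib key `AizenmanDuminilCopinSidoraviciusCMP2015`, "ADS15"):
  "The events `𝒞_E` with `E` ranging over finite sets of edges span (by inclusion–exclusion) the
  algebra of events expressible in terms of finite collections of the binary variables … implies
  the existence of `P̂^#_β`", and §2.3: `ℙ_β` is the law of `n̂₁ + n₂` for independent `n₁, n₂`.

**What is formalised is the trace analogue of the printed argument.** ADS15 (p. 9) run the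
inclusion–exclusion on the *parity* events `𝒞_E = {r_{x,y} = 1 on E}` and obtain R1 for the law of
the full (ℕ-valued) current; for the **trace** (the `{0,1}`-valued bond variables `n̂`, which is
all the double current `ℙ_{Λ_L,β} = adsDoubleCurrentLaw d L β` of `DoubleCurrents.lean` records)
the same inclusion–exclusion over the avoidance events `𝒞⁽⁰⁾_T = {n ≡ 0 on T}` of
`CurrentsEdgeAvoidance.lean` suffices, and this is what the file proves:

* `indicator_trace_eq_sum` — `𝟙[n̂ ∩ F = U] = ∑_{W ⊆ U} (-1)^{|W|} 𝟙[n ≡ 0 on (F ∖ U) ∪ W]`;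
* `plusCurrentTraceProb` / `freeCurrentTraceProb` (`P̂^#_{Λ_L,β}[n̂ ∩ F = U]`) and their
  inclusion–exclusion expansion (`plusCurrentTraceProb_eq_sum`, `freeCurrentTraceProb_eq_sum`),
  hence their limits (`tendsto_plusCurrentTraceProb`, `tendsto_freeCurrentTraceProb`);
* the **product structure of the double current** on such events,
  `ℙ_{Λ_L,β}[ω ∩ F = U] = ∑_{U₁ ∪ U₂ = U} P̂⁰_{Λ_L,β}[n̂₁ ∩ F = U₁] P̂⁺_{Λ_L,β}[n̂₂ ∩ F = U₂]`
  (`adsDoubleCurrentLaw_real_traceEvent_eq`), and the limit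
  `lim_L ℙ_{Λ_L,β}[ω ∩ F = U]` (`tendsto_adsDoubleCurrentLaw_traceEvent`, explicit value
  `adsTraceLimit d β F U`), for every finite set `F` of lattice bonds and `U ⊆ F`, `β ≥ 0`.

The events `{ω ∩ F = U}` are the tree's cylinders `localCylinder ↑F ↑U` (`PercolationEvents.lean`);
`isLocalEvent_localCylinder` records (for a general index type) that they are local events.

## Mathlib status

Anchors: `Finset.prod_one_add`, `Finset.prod_boole`, `Summable.tsum_finsetSum`,
`tsum_mul_tsum_of_summable_norm`, `Finset.sum_product`, `tendsto_finsetSum`.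
-/

noncomputable section

open MeasureTheory Filter Topology Finset Literature.Probability.LatticeModels Literature.Probability.Percolation
open scoped symmDiff

namespace Literature.Probability.LatticeModels

variable (d : ℕ)

/-! ### Inclusion–exclusion for "the trace, read on `F`, equals `U`" -/

open Classical in
/-- **Inclusion–exclusion**: for a set `A`, a finite set `F` and `U ⊆ F`,
`𝟙[∀ e ∈ F, (e ∈ U ↔ e ∈ A)] = ∑_{W ⊆ U} (-1)^{|W|} 𝟙[A avoids (F ∖ U) ∪ W]`. This is the trace
analogue (avoidance events `{n ≡ 0 on T}` in place of the parity events `𝒞_E`) of "the events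
`𝒞_E` span by inclusion–exclusion the algebra of events expressible in terms of finite collections
of the binary variables" in the ADS15 proof of Thm. 2.3 (R1); the identity itself is elementary. [cite: AizenmanDuminilCopinSidoraviciusCMP2015, Thm. 2.3 (R1), proof (trace analogue)] -/
theorem indicator_trace_eq_sum {α : Type*} [DecidableEq α] (A : Set α) {F U : Finset α} (hUF : U ⊆ F) :
    (if ∀ e ∈ F, (e ∈ U ↔ e ∈ A) then (1 : ℝ) else 0) =
      ∑ W ∈ U.powerset, (-1 : ℝ) ^ #W * (if ∀ e ∈ (F \ U) ∪ W, e ∉ A then (1 : ℝ) else 0) := by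
  -- `𝟙[A avoids (F∖U) ∪ W] = 𝟙[A avoids F∖U] · ∏_{e ∈ W} 𝟙[e ∉ A]`
  have h1 : ∀ W : Finset α, (if ∀ e ∈ (F \ U) ∪ W, e ∉ A then (1 : ℝ) else 0) =
      (if ∀ e ∈ F \ U, e ∉ A then (1 : ℝ) else 0) * ∏ e ∈ W, (if e ∉ A then (1 : ℝ) else 0) := by
    intro W
    rw [Finset.prod_boole]
    by_cases ha : ∀ e ∈ F \ U, e ∉ A
    · by_cases hb : ∀ e ∈ W, e ∉ A
      · rw [if_pos ha, if_pos hb, if_pos, one_mul]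
        intro e he
        rcases Finset.mem_union.1 he with he | he
        · exact ha e he
        · exact hb e he
      · rw [if_pos ha, if_neg hb, mul_zero, if_neg]
        intro h; exact hb fun e he => h e (Finset.mem_union_right _ he)
    · rw [if_neg ha, zero_mul, if_neg]
      intro h; exact ha fun e he => h e (Finset.mem_union_left _ he)
  simp_rw [h1]
  -- pull out the common factor and resum with `prod_one_add`
  have h2 : ∀ W : Finset α, (-1 : ℝ) ^ #W * ((if ∀ e ∈ F \ U, e ∉ A then (1 : ℝ) else 0) *
      ∏ e ∈ W, (if e ∉ A then (1 : ℝ) else 0)) =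
      (if ∀ e ∈ F \ U, e ∉ A then (1 : ℝ) else 0) * ∏ e ∈ W, (-(if e ∉ A then (1 : ℝ) else 0)) := by
    intro W
    rw [Finset.prod_neg, ← Finset.prod_const]
    ring
  simp_rw [h2]
  rw [← Finset.mul_sum, ← Finset.prod_one_add]
  have h3 : ∀ e : α, (1 + -(if e ∉ A then (1 : ℝ) else 0)) = if e ∈ A then 1 else 0 := by
    intro e; by_cases he : e ∈ A <;> simp [he]
  simp_rw [h3]
  rw [Finset.prod_boole]
  -- compare the two sides
  by_cases hL : ∀ e ∈ F, (e ∈ U ↔ e ∈ A)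
  · rw [if_pos hL, if_pos, if_pos, mul_one]
    · exact fun e he => (hL e (hUF he)).1 he
    · intro e he
      rw [Finset.mem_sdiff] at he
      exact fun h => he.2 ((hL e he.1).2 h)
  · rw [if_neg hL]
    by_cases ha : ∀ e ∈ F \ U, e ∉ A
    · rw [if_pos ha, one_mul, if_neg]
      intro hb
      apply hL
      intro e he
      by_cases heU : e ∈ U
      · exact ⟨fun _ => hb e heU, fun _ => heU⟩
      · exact ⟨fun h => absurd h heU, fun h => absurd h (ha e (Finset.mem_sdiff.2 ⟨he, heU⟩))⟩
    · rw [if_neg ha, zero_mul]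

/-! ### The box currents: avoidance read on the lifted trace -/

/-- A current of the plus box graph vanishes on the pulled-back bonds of `T` iff its lifted trace
avoids `T`. [folklore] -/
theorem forall_boxBonds_eq_zero_iff {L : ℕ} (T : Finset (Sym2 (Site d))) (n : Current (plusBoxGraph d L)) :
    (∀ e : (plusBoxGraph d L).edgeFinset, (e : Sym2 (BoxVertex d L)) ∈ boxBonds d L T → n e = 0) ↔
      ∀ e ∈ T, e ∉ liftBonds d L n.traced := by
  constructor
  · intro h e heT ⟨e', he', hee'⟩
    obtain ⟨hG, hpos⟩ := he'
    have h0 := h ⟨e', hG⟩ (by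
      rw [boxBonds, Finset.mem_filter]
      exact ⟨hG, by rw [hee']; exact heT⟩)
    rw [h0] at hpos
    exact lt_irrefl 0 hpos
  · intro h e he
    rw [boxBonds, Finset.mem_filter] at he
    by_contra hne
    exact h _ he.2 ⟨e, ⟨e.2, Nat.pos_of_ne_zero hne⟩, rfl⟩

/-- Free version of `forall_boxBonds_eq_zero_iff`. [folklore] -/
theorem forall_freeBoxBonds_eq_zero_iff {L : ℕ} (T : Finset (Sym2 (Site d))) (n : Current (freeBoxGraph d L)) :
    (∀ e : (freeBoxGraph d L).edgeFinset, (e : Sym2 (BoxVertex d L)) ∈ freeBoxBonds d L T → n e = 0) ↔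
      ∀ e ∈ T, e ∉ liftBonds d L n.traced := by
  constructor
  · intro h e heT ⟨e', he', hee'⟩
    obtain ⟨hG, hpos⟩ := he'
    have h0 := h ⟨e', hG⟩ (by
      rw [freeBoxBonds, Finset.mem_filter]
      exact ⟨hG, by rw [hee']; exact heT⟩)
    rw [h0] at hpos
    exact lt_irrefl 0 hpos
  · intro h e he
    rw [freeBoxBonds, Finset.mem_filter] at he
    by_contra hne
    exact h _ he.2 ⟨e, ⟨e.2, Nat.pos_of_ne_zero hne⟩, rfl⟩

/-! ### `P̂^#_{Λ_L,β}[n̂ ∩ F = U]` and its inclusion–exclusion expansion -/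

open Classical in
/-- **`P̂⁺_{Λ_L,β}[n̂ ∩ F = U]`**: the probability that the lifted trace of the sourceless `+` current of
`Λ_L`, read on the finite set of bonds `F`, is exactly `U` (trace analogue of the parity events
`𝒞_E` of the printed proof). [cite: AizenmanDuminilCopinSidoraviciusCMP2015, Thm. 2.3 (R1), proof (trace analogue)] -/
def plusCurrentTraceProb (L : ℕ) (β : ℝ) (F U : Finset (Sym2 (Site d))) : ℝ :=
  (∑' n : Current (plusBoxGraph d L),
    if n.sources ∩ boxCore d L = ∅ ∧ ∀ e ∈ F, (e ∈ U ↔ e ∈ liftBonds d L n.traced) then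
      n.weight β else 0) / plusCurrentSum (plusBoxGraph d L) (boxCore d L) β ∅

open Classical in
/-- **`P̂⁰_{Λ_L,β}[n̂ ∩ F = U]`**, free boundary condition (trace analogue of the parity events of
the printed proof). [cite: AizenmanDuminilCopinSidoraviciusCMP2015, Thm. 2.3 (R1), proof (trace analogue)] -/
def freeCurrentTraceProb (L : ℕ) (β : ℝ) (F U : Finset (Sym2 (Site d))) : ℝ :=
  (∑' n : Current (freeBoxGraph d L),
    if n.sources ∩ boxCore d L = ∅ ∧ ∀ e ∈ F, (e ∈ U ↔ e ∈ liftBonds d L n.traced) then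
      n.weight β else 0) / plusCurrentSum (freeBoxGraph d L) (boxCore d L) β ∅

section SingleCurrent

variable {V : Type*} [Fintype V] [DecidableEq V] (G : SimpleGraph V) [DecidableRel G.Adj]

omit [DecidableEq V] in
/-- Summability of weights restricted by any decidable predicate. [folklore] -/
theorem summable_ite_weight (β : ℝ) (P : Current G → Prop) [DecidablePred P] :
    Summable fun n : Current G => if P n then n.weight β else 0 :=
  (Current.summable_weight_abs G β).of_norm_bounded fun n => by
    split_ifs
    · rw [Real.norm_eq_abs, Current.abs_weight]
    · rw [norm_zero]; exact Current.weight_nonneg (abs_nonneg β) n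

open Classical in
/-- **Inclusion–exclusion at the level of the generating sums**: for `U ⊆ F` and a trace map
`tr`, `∑_{∂n∩Λ=∅, tr(n) ∩ F = U} w = ∑_{W ⊆ U} (-1)^{|W|} ∑_{∂n∩Λ=∅, tr(n) avoids (F∖U) ∪ W} w`
(trace analogue of the inclusion–exclusion of the printed proof). [cite: AizenmanDuminilCopinSidoraviciusCMP2015, Thm. 2.3 (R1), proof (trace analogue)] -/
theorem tsum_trace_eq_sum {α : Type*} [DecidableEq α] (Λ : Finset V) (β : ℝ) (tr : Current G → Set α)
    {F U : Finset α} (hUF : U ⊆ F) :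
    ∑' n : Current G, (if n.sources ∩ Λ = ∅ ∧ ∀ e ∈ F, (e ∈ U ↔ e ∈ tr n) then n.weight β else 0) =
      ∑ W ∈ U.powerset, (-1 : ℝ) ^ #W *
        ∑' n : Current G, (if n.sources ∩ Λ = ∅ ∧ ∀ e ∈ (F \ U) ∪ W, e ∉ tr n then n.weight β else 0) := by
  have hterm : ∀ n : Current G,
      (if n.sources ∩ Λ = ∅ ∧ ∀ e ∈ F, (e ∈ U ↔ e ∈ tr n) then n.weight β else 0) =
      ∑ W ∈ U.powerset, (-1 : ℝ) ^ #W *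
        (if n.sources ∩ Λ = ∅ ∧ ∀ e ∈ (F \ U) ∪ W, e ∉ tr n then n.weight β else 0) := by
    intro n
    by_cases hs : n.sources ∩ Λ = ∅
    · have key := indicator_trace_eq_sum (tr n) hUF
      have hl : (if n.sources ∩ Λ = ∅ ∧ ∀ e ∈ F, (e ∈ U ↔ e ∈ tr n) then n.weight β else 0) =
          n.weight β * (if ∀ e ∈ F, (e ∈ U ↔ e ∈ tr n) then (1 : ℝ) else 0) := by
        by_cases h2 : ∀ e ∈ F, (e ∈ U ↔ e ∈ tr n)
        · rw [if_pos ⟨hs, h2⟩, if_pos h2, mul_one]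
        · rw [if_neg (fun h => h2 h.2), if_neg h2, mul_zero]
      have hr : ∀ W : Finset α, (if n.sources ∩ Λ = ∅ ∧ ∀ e ∈ (F \ U) ∪ W, e ∉ tr n then n.weight β else 0)
          = n.weight β * (if ∀ e ∈ (F \ U) ∪ W, e ∉ tr n then (1 : ℝ) else 0) := by
        intro W
        by_cases h2 : ∀ e ∈ (F \ U) ∪ W, e ∉ tr n
        · rw [if_pos ⟨hs, h2⟩, if_pos h2, mul_one]
        · rw [if_neg (fun h => h2 h.2), if_neg h2, mul_zero]
      rw [hl, key, Finset.mul_sum]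
      refine Finset.sum_congr rfl fun W _ => ?_
      rw [hr W]; ring
    · rw [if_neg (fun h => hs h.1)]
      symm
      refine Finset.sum_eq_zero fun W _ => ?_
      rw [if_neg (fun h => hs h.1), mul_zero]
  simp_rw [hterm]
  rw [Summable.tsum_finsetSum (fun W _ => (summable_ite_weight G β _).mul_left _)]
  refine Finset.sum_congr rfl fun W _ => ?_
  exact tsum_mul_left

end SingleCurrent

/-- **`P̂⁺_{Λ_L,β}[n̂ ∩ F = U] = ∑_{W ⊆ U} (-1)^{|W|} P̂⁺_{Λ_L,β}[n ≡ 0 on (F ∖ U) ∪ W]`** for `U ⊆ F`. [cite: AizenmanDuminilCopinSidoraviciusCMP2015, Thm. 2.3 (R1), proof] -/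
theorem plusCurrentTraceProb_eq_sum (L : ℕ) (β : ℝ) {F U : Finset (Sym2 (Site d))} (hUF : U ⊆ F) :
    plusCurrentTraceProb d L β F U =
      ∑ W ∈ U.powerset, (-1 : ℝ) ^ #W * plusCurrentAvoidProb d L β ((F \ U) ∪ W) := by
  classical
  have h := tsum_trace_eq_sum (plusBoxGraph d L) (boxCore d L) β (fun n => liftBonds d L n.traced) hUF
  unfold plusCurrentTraceProb plusCurrentAvoidProb plusCurrentSumAvoid
  rw [h, Finset.sum_div]
  refine Finset.sum_congr rfl fun W _ => ?_
  rw [mul_div_assoc]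
  congr 2
  refine tsum_congr fun n => ?_
  simp only [forall_boxBonds_eq_zero_iff]

/-- **`P̂⁰_{Λ_L,β}[n̂ ∩ F = U] = ∑_{W ⊆ U} (-1)^{|W|} P̂⁰_{Λ_L,β}[n ≡ 0 on (F ∖ U) ∪ W]`** for `U ⊆ F`. [cite: AizenmanDuminilCopinSidoraviciusCMP2015, Thm. 2.3 (R1), proof] -/
theorem freeCurrentTraceProb_eq_sum (L : ℕ) (β : ℝ) {F U : Finset (Sym2 (Site d))} (hUF : U ⊆ F) :
    freeCurrentTraceProb d L β F U =
      ∑ W ∈ U.powerset, (-1 : ℝ) ^ #W * freeCurrentAvoidProb d L β ((F \ U) ∪ W) := by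
  classical
  have h := tsum_trace_eq_sum (freeBoxGraph d L) (boxCore d L) β (fun n => liftBonds d L n.traced) hUF
  unfold freeCurrentTraceProb freeCurrentAvoidProb plusCurrentSumAvoid
  rw [h, Finset.sum_div]
  refine Finset.sum_congr rfl fun W _ => ?_
  rw [mul_div_assoc]
  congr 2
  refine tsum_congr fun n => ?_
  simp only [forall_freeBoxBonds_eq_zero_iff]

/-- The limit `lim_L P̂⁺_{Λ_L,β}[n̂ ∩ F = U]`. [cite: AizenmanDuminilCopinSidoraviciusCMP2015, Thm. 2.3 (R1), proof] -/
def plusCurrentTraceLimit (β : ℝ) (F U : Finset (Sym2 (Site d))) : ℝ :=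
  ∑ W ∈ U.powerset, (-1 : ℝ) ^ #W * plusCurrentAvoidLimit d β ((F \ U) ∪ W)

/-- The limit `lim_L P̂⁰_{Λ_L,β}[n̂ ∩ F = U]`. [cite: AizenmanDuminilCopinSidoraviciusCMP2015, Thm. 2.3 (R1), proof] -/
def freeCurrentTraceLimit (β : ℝ) (F U : Finset (Sym2 (Site d))) : ℝ :=
  ∑ W ∈ U.powerset, (-1 : ℝ) ^ #W * freeCurrentAvoidLimit d β ((F \ U) ∪ W)

/-- **Convergence of `P̂⁺_{Λ_L,β}[n̂ ∩ F = U]`** for a finite set `F` of lattice bonds, `U ⊆ F`, `β ≥ 0`. [cite: AizenmanDuminilCopinSidoraviciusCMP2015, Thm. 2.3 (R1), proof] -/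
theorem tendsto_plusCurrentTraceProb {β : ℝ} (hβ : 0 ≤ β) {F U : Finset (Sym2 (Site d))}
    (hF : ↑F ⊆ (zdGraph d).edgeSet) (hUF : U ⊆ F) :
    Tendsto (fun L : ℕ => plusCurrentTraceProb d L β F U) atTop (𝓝 (plusCurrentTraceLimit d β F U)) := by
  unfold plusCurrentTraceLimit
  simp_rw [plusCurrentTraceProb_eq_sum d _ β hUF]
  refine tendsto_finsetSum _ fun W hW => (tendsto_plusCurrentAvoidProb d hβ ?_).const_mul _
  rw [Finset.mem_powerset] at hW
  intro e he
  rw [Finset.coe_union, Set.mem_union, Finset.mem_coe, Finset.mem_coe, Finset.mem_sdiff] at he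
  rcases he with ⟨he, -⟩ | he
  · exact hF he
  · exact hF (hUF (hW he))

/-- **Convergence of `P̂⁰_{Λ_L,β}[n̂ ∩ F = U]`** for a finite set `F` of lattice bonds, `U ⊆ F`, `β ≥ 0`. [cite: AizenmanDuminilCopinSidoraviciusCMP2015, Thm. 2.3 (R1), proof] -/
theorem tendsto_freeCurrentTraceProb {β : ℝ} (hβ : 0 ≤ β) {F U : Finset (Sym2 (Site d))}
    (hF : ↑F ⊆ (zdGraph d).edgeSet) (hUF : U ⊆ F) :
    Tendsto (fun L : ℕ => freeCurrentTraceProb d L β F U) atTop (𝓝 (freeCurrentTraceLimit d β F U)) := by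
  unfold freeCurrentTraceLimit
  simp_rw [freeCurrentTraceProb_eq_sum d _ β hUF]
  refine tendsto_finsetSum _ fun W hW => (tendsto_freeCurrentAvoidProb d hβ ?_).const_mul _
  rw [Finset.mem_powerset] at hW
  intro e he
  rw [Finset.coe_union, Set.mem_union, Finset.mem_coe, Finset.mem_coe, Finset.mem_sdiff] at he
  rcases he with ⟨he, -⟩ | he
  · exact hF he
  · exact hF (hUF (hW he))

/-! ### The double current on the cylinders `{ω ∩ F = U}` -/

/-- Cylinders over a finite index set are local events (general form; the events
"`ω`, read on `F`, equals `U`" below are the tree's `localCylinder ↑F ↑U`). [folklore] -/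
theorem isLocalEvent_localCylinder {ι : Type*} (F : Finset ι) (ω : Set ι) :
    IsLocalEvent (localCylinder (↑F : Set ι) ω) := by
  refine ⟨F, ?_⟩
  rw [determinedBy_iff]
  intro ω₁ ω₂ h
  simp only [localCylinder, Set.mem_setOf_eq, Finset.mem_coe]
  have key : ∀ e ∈ F, (e ∈ ω₁ ↔ e ∈ ω₂) := fun e he =>
    ⟨fun h₁ => ((Set.ext_iff.1 h e).1 ⟨h₁, he⟩).1, fun h₂ => ((Set.ext_iff.1 h e).2 ⟨h₂, he⟩).1⟩
  exact forall₂_congr fun e he => by rw [key e he]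

/-- Membership in a cylinder over `Finset`s, in the orientation `e ∈ U ↔ e ∈ A` used by the trace
probabilities of this file. [folklore] -/
theorem mem_localCylinder_coe_iff {ι : Type*} (F U : Finset ι) (A : Set ι) :
    A ∈ localCylinder (↑F : Set ι) ↑U ↔ ∀ e ∈ F, (e ∈ U ↔ e ∈ A) :=
  forall₂_congr fun _ _ => Iff.comm

open Classical in
/-- **The trace of a union splits uniquely**: for sets `A₁, A₂` and `U ⊆ F`,
`𝟙[∀ e ∈ F, (e ∈ U ↔ e ∈ A₁ ∪ A₂)] = ∑_{U₁, U₂ ⊆ U, U₁ ∪ U₂ = U} 𝟙[∀ e ∈ F, (e ∈ U₁ ↔ e ∈ A₁)] 𝟙[∀ e ∈ F, (e ∈ U₂ ↔ e ∈ A₂)]`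
(the only contributing pair is `U_i = {e ∈ F | e ∈ A_i}`). [folklore] -/
theorem indicator_trace_union_eq_sum {α : Type*} [DecidableEq α] (A₁ A₂ : Set α) {F U : Finset α} (hUF : U ⊆ F) :
    (if ∀ e ∈ F, (e ∈ U ↔ e ∈ A₁ ∪ A₂) then (1 : ℝ) else 0) =
      ∑ U₁ ∈ U.powerset, ∑ U₂ ∈ U.powerset, if U₁ ∪ U₂ = U then
        (if ∀ e ∈ F, (e ∈ U₁ ↔ e ∈ A₁) then (1 : ℝ) else 0) *
          (if ∀ e ∈ F, (e ∈ U₂ ↔ e ∈ A₂) then (1 : ℝ) else 0) else 0 := by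
  set T₁ : Finset α := F.filter (· ∈ A₁) with hT₁
  set T₂ : Finset α := F.filter (· ∈ A₂) with hT₂
  -- the indicator `𝟙[∀ e ∈ F, (e ∈ U_i ↔ e ∈ A_i)]` is `𝟙[U_i = T_i]` for `U_i ⊆ F`
  have hind : ∀ (A : Set α) (Uᵢ : Finset α), Uᵢ ⊆ F →
      ((∀ e ∈ F, (e ∈ Uᵢ ↔ e ∈ A)) ↔ Uᵢ = F.filter (· ∈ A)) := by
    intro A Uᵢ hUᵢ
    constructor
    · intro h
      ext e
      rw [Finset.mem_filter]
      exact ⟨fun he => ⟨hUᵢ he, (h e (hUᵢ he)).1 he⟩, fun he => (h e he.1).2 he.2⟩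
    · rintro rfl e he
      rw [Finset.mem_filter]
      exact ⟨fun h => h.2, fun h => ⟨he, h⟩⟩
  -- evaluate the double sum
  have hsum : ∑ U₁ ∈ U.powerset, ∑ U₂ ∈ U.powerset, (if U₁ ∪ U₂ = U then
        (if ∀ e ∈ F, (e ∈ U₁ ↔ e ∈ A₁) then (1 : ℝ) else 0) *
          (if ∀ e ∈ F, (e ∈ U₂ ↔ e ∈ A₂) then (1 : ℝ) else 0) else 0) =
      if T₁ ⊆ U ∧ T₂ ⊆ U ∧ T₁ ∪ T₂ = U then 1 else 0 := by
    have hvan : ∀ U₁ ∈ U.powerset, ∀ U₂ ∈ U.powerset, (U₁ ≠ T₁ ∨ U₂ ≠ T₂) →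
        (if U₁ ∪ U₂ = U then
          (if ∀ e ∈ F, (e ∈ U₁ ↔ e ∈ A₁) then (1 : ℝ) else 0) *
            (if ∀ e ∈ F, (e ∈ U₂ ↔ e ∈ A₂) then (1 : ℝ) else 0) else 0) = 0 := by
      intro U₁ hU₁ U₂ hU₂ hne
      rw [Finset.mem_powerset] at hU₁ hU₂
      by_cases h : U₁ ∪ U₂ = U
      · rw [if_pos h]
        rcases hne with hne | hne
        · rw [if_neg (fun h1 => hne ((hind A₁ U₁ (hU₁.trans hUF)).1 h1)), zero_mul]
        · rw [if_neg (fun h2 => hne ((hind A₂ U₂ (hU₂.trans hUF)).1 h2)), mul_zero]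
      · rw [if_neg h]
    by_cases hT : T₁ ⊆ U ∧ T₂ ⊆ U ∧ T₁ ∪ T₂ = U
    · rw [if_pos hT]
      rw [Finset.sum_eq_single_of_mem T₁ (Finset.mem_powerset.2 hT.1) (fun U₁ hU₁ hne =>
        Finset.sum_eq_zero fun U₂ hU₂ => hvan U₁ hU₁ U₂ hU₂ (Or.inl hne))]
      rw [Finset.sum_eq_single_of_mem T₂ (Finset.mem_powerset.2 hT.2.1) (fun U₂ hU₂ hne =>
        hvan T₁ (Finset.mem_powerset.2 hT.1) U₂ hU₂ (Or.inr hne))]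
      rw [if_pos hT.2.2, if_pos ((hind A₁ T₁ (Finset.filter_subset _ _)).2 rfl),
        if_pos ((hind A₂ T₂ (Finset.filter_subset _ _)).2 rfl), mul_one]
    · rw [if_neg hT]
      refine Finset.sum_eq_zero fun U₁ hU₁ => Finset.sum_eq_zero fun U₂ hU₂ => ?_
      by_cases hne : U₁ ≠ T₁ ∨ U₂ ≠ T₂
      · exact hvan U₁ hU₁ U₂ hU₂ hne
      · push Not at hne
        obtain ⟨rfl, rfl⟩ := hne
        rw [Finset.mem_powerset] at hU₁ hU₂
        rw [if_neg fun h => hT ⟨hU₁, hU₂, h⟩]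
  rw [hsum]
  -- compare with the left-hand side
  have hLiff : (∀ e ∈ F, (e ∈ U ↔ e ∈ A₁ ∪ A₂)) ↔ U = T₁ ∪ T₂ := by
    rw [hind (A₁ ∪ A₂) U hUF, hT₁, hT₂, ← Finset.filter_or]
    simp only [Set.mem_union]
  by_cases hL : ∀ e ∈ F, (e ∈ U ↔ e ∈ A₁ ∪ A₂)
  · rw [if_pos hL, if_pos]
    have hU := hLiff.1 hL
    refine ⟨hU ▸ Finset.subset_union_left, hU ▸ Finset.subset_union_right, hU.symm⟩
  · rw [if_neg hL, if_neg]
    rintro ⟨-, -, h⟩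
    exact hL (hLiff.2 h.symm)

/-- Lifting commutes with unions. [folklore] -/
theorem liftBonds_union {L : ℕ} (ω ω' : BondConfig (BoxVertex d L)) :
    liftBonds d L (ω ∪ ω') = liftBonds d L ω ∪ liftBonds d L ω' :=
  Set.image_union _ _ _

open Classical in
/-- **The double current factorises on the cylinders `{ω ∩ F = U}`** (ADS15 §2.3/(3.1): `ℙ_{Λ_L,β}`
is the law of `n̂₁ ∪ n̂₂` for independent `n₁ ∼ P⁰_{Λ_L,β}`, `n₂ ∼ P⁺_{Λ_L,β}`): for `β ≥ 0` and
`U ⊆ F`,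
`ℙ_{Λ_L,β}[ω ∩ F = U] = ∑_{U₁,U₂ ⊆ U, U₁ ∪ U₂ = U} P̂⁰_{Λ_L,β}[n̂₁ ∩ F = U₁] · P̂⁺_{Λ_L,β}[n̂₂ ∩ F = U₂]`. [cite: AizenmanDuminilCopinSidoraviciusCMP2015, §2.3 and §3.1, eq. (3.1)] -/
theorem adsDoubleCurrentLaw_real_traceEvent_eq (L : ℕ) {β : ℝ} (hβ : 0 ≤ β)
    {F U : Finset (Sym2 (Site d))} (hUF : U ⊆ F) :
    (adsDoubleCurrentLaw d L β).real (localCylinder (↑F : Set (Sym2 (Site d))) ↑U) =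
      ∑ U₁ ∈ U.powerset, ∑ U₂ ∈ U.powerset, if U₁ ∪ U₂ = U then
        freeCurrentTraceProb d L β F U₁ * plusCurrentTraceProb d L β F U₂ else 0 := by
  have hN := adsPairNorm_pos d L hβ
  rw [adsDoubleCurrentLaw_real_apply d L hβ hN]
  -- the summand, with the pair weight factorised and the indicator split
  set f : Finset (Sym2 (Site d)) → Current (freeBoxGraph d L) → ℝ := fun U₁ n =>
    if n.sources ∩ boxCore d L = ∅ ∧ ∀ e ∈ F, (e ∈ U₁ ↔ e ∈ liftBonds d L n.traced) then n.weight β else 0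
    with hf
  set g : Finset (Sym2 (Site d)) → Current (plusBoxGraph d L) → ℝ := fun U₂ n =>
    if n.sources ∩ boxCore d L = ∅ ∧ ∀ e ∈ F, (e ∈ U₂ ↔ e ∈ liftBonds d L n.traced) then n.weight β else 0
    with hg
  have hterm : ∀ p : Current (freeBoxGraph d L) × Current (plusBoxGraph d L),
      adsPairWeight d L β p / adsPairNorm d L β *
        (if liftBonds d L (p.1.traced ∪ p.2.traced) ∈ localCylinder (↑F : Set (Sym2 (Site d))) ↑U then (1 : ℝ) else 0) =
      ∑ U₁ ∈ U.powerset, ∑ U₂ ∈ U.powerset, if U₁ ∪ U₂ = U then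
        (adsPairNorm d L β)⁻¹ * (f U₁ p.1 * g U₂ p.2) else 0 := by
    intro p
    have hind : (if liftBonds d L (p.1.traced ∪ p.2.traced) ∈ localCylinder (↑F : Set (Sym2 (Site d))) ↑U then (1 : ℝ) else 0) =
        if ∀ e ∈ F, (e ∈ U ↔ e ∈ liftBonds d L p.1.traced ∪ liftBonds d L p.2.traced) then 1 else 0 := by
      simp only [mem_localCylinder_coe_iff, liftBonds_union]
    rw [hind, indicator_trace_union_eq_sum _ _ hUF, adsPairWeight_eq_mul, Finset.mul_sum]
    refine Finset.sum_congr rfl fun U₁ _ => ?_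
    rw [Finset.mul_sum]
    refine Finset.sum_congr rfl fun U₂ _ => ?_
    by_cases h : U₁ ∪ U₂ = U
    · rw [if_pos h, if_pos h]
      have e₁ : f U₁ p.1 = (if p.1.sources ∩ boxCore d L = ∅ then p.1.weight β else 0) *
          (if ∀ e ∈ F, (e ∈ U₁ ↔ e ∈ liftBonds d L p.1.traced) then (1 : ℝ) else 0) := by
        simp only [hf]; rw [ite_zero_mul_ite_zero, mul_one]
      have e₂ : g U₂ p.2 = (if p.2.sources ∩ boxCore d L = ∅ then p.2.weight β else 0) *
          (if ∀ e ∈ F, (e ∈ U₂ ↔ e ∈ liftBonds d L p.2.traced) then (1 : ℝ) else 0) := by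
        simp only [hg]; rw [ite_zero_mul_ite_zero, mul_one]
      rw [e₁, e₂]
      ring
    · rw [if_neg h, if_neg h, mul_zero]
  simp_rw [hterm]
  -- exchange the `tsum` with the finite sums
  have hsF : ∀ U₁, Summable (f U₁) := fun U₁ => by
    simp only [hf]; exact summable_ite_weight _ β _
  have hsG : ∀ U₂, Summable (g U₂) := fun U₂ => by
    simp only [hg]; exact summable_ite_weight _ β _
  have hfle : ∀ U₁ n, |f U₁ n| ≤ n.weight β := fun U₁ n => by
    simp only [hf]; split_ifs
    · rw [abs_of_nonneg (Current.weight_nonneg hβ n)]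
    · rw [abs_zero]; exact Current.weight_nonneg hβ n
  have hgle : ∀ U₂ n, |g U₂ n| ≤ n.weight β := fun U₂ n => by
    simp only [hg]; split_ifs
    · rw [abs_of_nonneg (Current.weight_nonneg hβ n)]
    · rw [abs_zero]; exact Current.weight_nonneg hβ n
  have hprodS : ∀ U₁ U₂, Summable fun p : Current (freeBoxGraph d L) × Current (plusBoxGraph d L) =>
      f U₁ p.1 * g U₂ p.2 := by
    intro U₁ U₂
    have h := (summable_currentWeight_holds (freeBoxGraph d L) β).mul_of_nonneg
      (summable_currentWeight_holds (plusBoxGraph d L) β) (fun n => Current.weight_nonneg hβ n)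
      (fun n => Current.weight_nonneg hβ n)
    refine h.of_norm_bounded fun p => ?_
    rw [Real.norm_eq_abs, abs_mul]
    exact mul_le_mul (hfle U₁ p.1) (hgle U₂ p.2) (abs_nonneg _) (Current.weight_nonneg hβ _)
  have hS : ∀ U₁ U₂, Summable fun p : Current (freeBoxGraph d L) × Current (plusBoxGraph d L) =>
      if U₁ ∪ U₂ = U then (adsPairNorm d L β)⁻¹ * (f U₁ p.1 * g U₂ p.2) else 0 := by
    intro U₁ U₂
    by_cases h : U₁ ∪ U₂ = U
    · simp only [if_pos h]; exact (hprodS U₁ U₂).mul_left _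
    · simp only [if_neg h]; exact summable_zero
  have hfn : ∀ U₁, Summable fun n => ‖f U₁ n‖ := fun U₁ =>
    Summable.of_nonneg_of_le (fun n => norm_nonneg _) (fun n => by rw [Real.norm_eq_abs]; exact hfle U₁ n)
      (summable_currentWeight_holds (freeBoxGraph d L) β)
  have hgn : ∀ U₂, Summable fun n => ‖g U₂ n‖ := fun U₂ =>
    Summable.of_nonneg_of_le (fun n => norm_nonneg _) (fun n => by rw [Real.norm_eq_abs]; exact hgle U₂ n)
      (summable_currentWeight_holds (plusBoxGraph d L) β)
  rw [Summable.tsum_finsetSum (fun U₁ _ => summable_sum fun U₂ _ => hS U₁ U₂)]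
  refine Finset.sum_congr rfl fun U₁ _ => ?_
  rw [Summable.tsum_finsetSum (fun U₂ _ => hS U₁ U₂)]
  refine Finset.sum_congr rfl fun U₂ _ => ?_
  by_cases h : U₁ ∪ U₂ = U
  · simp only [if_pos h]
    have hfree : freeCurrentTraceProb d L β F U₁ =
        (∑' n, f U₁ n) / plusCurrentSum (freeBoxGraph d L) (boxCore d L) β ∅ := rfl
    have hplus : plusCurrentTraceProb d L β F U₂ =
        (∑' n, g U₂ n) / plusCurrentSum (plusBoxGraph d L) (boxCore d L) β ∅ := rfl
    have hZ₀ := plusCurrentSum_empty_pos (freeBoxGraph d L) (edgesTouching_freeBoxGraph d L) β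
    have hZ := plusCurrentSum_empty_pos (plusBoxGraph d L) (edgesTouching_plusBoxGraph d L) β
    rw [hfree, hplus, tsum_mul_left, ← tsum_mul_tsum_of_summable_norm (hfn U₁) (hgn U₂),
      adsPairNorm_eq_mul d L hβ]
    field_simp
  · simp only [if_neg h, tsum_zero]

/-- The limit `lim_L ℙ_{Λ_L,β}[ω ∩ F = U]` (explicit, from the limits of the two trace laws). [cite: AizenmanDuminilCopinSidoraviciusCMP2015, Thm. 2.3 (R1) and §2.3] -/
def adsTraceLimit (β : ℝ) (F U : Finset (Sym2 (Site d))) : ℝ :=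
  ∑ U₁ ∈ U.powerset, ∑ U₂ ∈ U.powerset, if U₁ ∪ U₂ = U then
    freeCurrentTraceLimit d β F U₁ * plusCurrentTraceLimit d β F U₂ else 0

/-- **Convergence of the double current on the cylinders `{ω ∩ F = U}`** (ADS15 Thm. 2.3 R1 for the
pair of currents, read on the trace; §2.3 and proof of Lemma 2.6: "`ℙ_{Λ_n,β}` converges weakly to
`ℙ_β`"): for `β ≥ 0`, a finite set `F` of lattice bonds and `U ⊆ F`,
`ℙ_{Λ_L,β}[ω ∩ F = U] → adsTraceLimit d β F U` as `L → ∞`. [cite: AizenmanDuminilCopinSidoraviciusCMP2015, Thm. 2.3 (R1) and §2.3] -/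
theorem tendsto_adsDoubleCurrentLaw_traceEvent {β : ℝ} (hβ : 0 ≤ β) {F U : Finset (Sym2 (Site d))}
    (hF : ↑F ⊆ (zdGraph d).edgeSet) (hUF : U ⊆ F) :
    Tendsto (fun L : ℕ => (adsDoubleCurrentLaw d L β).real (localCylinder (↑F : Set (Sym2 (Site d))) ↑U)) atTop
      (𝓝 (adsTraceLimit d β F U)) := by
  unfold adsTraceLimit
  simp_rw [adsDoubleCurrentLaw_real_traceEvent_eq d _ hβ hUF]
  refine tendsto_finsetSum _ fun U₁ hU₁ => tendsto_finsetSum _ fun U₂ hU₂ => ?_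
  rw [Finset.mem_powerset] at hU₁ hU₂
  by_cases h : U₁ ∪ U₂ = U
  · simp only [if_pos h]
    exact (tendsto_freeCurrentTraceProb d hβ hF (hU₁.trans hUF)).mul
      (tendsto_plusCurrentTraceProb d hβ hF (hU₂.trans hUF))
  · simp only [if_neg h]
    exact tendsto_const_nhds

end Literature.Probability.LatticeModels
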